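import Summits.ResolutionOfSingularities.ResolutionOfSingularities.Theorems.LossEntryPolygon2
import Summits.ResolutionOfSingularities.ResolutionOfSingularities.Theorems.LossShearX2Line
import Summits.ResolutionOfSingularities.ResolutionOfSingularities.Theorems.LossEpisodePencil
import HarnessLib

/-!
# LossEntryW01 — walk plumbing of the loss→entry law `LawLossEntry`, part 1/11

decomp-res-lens-3, gen 29 (HOME/decomp-res-lens-3/g29/NODE-g29.md).  TOOL at 0 toward the residual item
stmt-ResolutionOfSingularities-27367 (`WallCut.NoLossyStrictTailsDeep` ⟸ `LossEpisode.LawLossEntry`).  Imports the landed T8b (`Theorems.LossEntryPolygon2`), `Theorems.LossShearX2Line`, `Theorems.LossEpisodePencil`.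

Contents: §1 two-shear step, §2 shears act degree by degree, §3 the (b)-pencil / apex of the prepared equation.
-/

open MvPolynomial Finset
open Literature.AlgebraicGeometry.Resolution
open Literature.AlgebraicGeometry.Resolution.Hauser2010
open Literature.AlgebraicGeometry.Resolution.PointBlowup
open Summit.ResolutionOfSingularities.ResolutionOfSingularities.Theorems.TightDefectClasses
open Summit.ResolutionOfSingularities.ResolutionOfSingularities.Theorems.TightDefectStrongWalks
open Summit.ResolutionOfSingularities.ResolutionOfSingularities.Theorems.ItineraryCutClasses
open Summit.ResolutionOfSingularities.ResolutionOfSingularities.Theorems.BoundaryLedger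
open Summit.ResolutionOfSingularities.ResolutionOfSingularities.Theorems.ProximityCut
open Summit.ResolutionOfSingularities.ResolutionOfSingularities.Theorems.LossIsFatalLayer (chartMap chartMap_X chartMap_X_self
  chartMap_X_ne chartMap_C)
open Summit.ResolutionOfSingularities.ResolutionOfSingularities.Theorems.LossExitCone
open Summit.ResolutionOfSingularities.ResolutionOfSingularities.Theorems.LossPolygon

/-! ## §1 The two-shear step: a move translated along both non-chart letters -/

namespace Summit.ResolutionOfSingularities.ResolutionOfSingularities.Theorems.LossPolygon

variable {K : Type} [Field K] [DecidableEq K]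
variable {q : ℕ} {s₀ : State (Fin 3) K}

-- `translate_translate` (composition of translations) is the tree's `LossExitCone.translate_translate` —
-- cited, not restated (gate `dedup.landed`; writer deviation, everything else verbatim).

/-- The chart map of exponents is injective on exponents of degree `≥ q`. [folklore] -/
theorem chartExponent_injective_of_le {j : Fin 3} {D E : Fin 3 →₀ ℕ} (hD : q ≤ D.degree) (hE : q ≤ E.degree)
    (h : chartExponent q j D = chartExponent q j E) : D = E := by
  classical
  obtain ⟨a, b, hab, haj, hbj⟩ : ∃ a b : Fin 3, a ≠ b ∧ a ≠ j ∧ b ≠ j := by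
    fin_cases j
    · exact ⟨1, 2, by decide, by decide, by decide⟩
    · exact ⟨0, 2, by decide, by decide, by decide⟩
    · exact ⟨0, 1, by decide, by decide, by decide⟩
  have hja : chartExponent q j D a = chartExponent q j E a := by rw [h]
  have hjb : chartExponent q j D b = chartExponent q j E b := by rw [h]
  have hjj : chartExponent q j D j = chartExponent q j E j := by rw [h]
  rw [chartExponent_apply, chartExponent_apply, if_neg haj, if_neg haj] at hja
  rw [chartExponent_apply, chartExponent_apply, if_neg hbj, if_neg hbj] at hjb
  rw [chartExponent_apply, chartExponent_apply, if_pos rfl, if_pos rfl] at hjj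
  have hdD := degree_fin3 hab haj hbj D
  have hdE := degree_fin3 hab haj hbj E
  have hDj : D j = E j := by omega
  ext w
  rcases fin3_eq_or a b j w hab haj hbj with rfl | rfl | rfl
  · exact hja
  · exact hjb
  · exact hDj

/-- **A MOVE TRANSLATED ALONG BOTH NON-CHART LETTERS IS THE UNTRANSLATED MOVE OF THE TWICE-SHEARED EQUATION (PROVED):**
in the chart `a` with `b_t = b c·e_c + b c'·e_{c'}` (`b_t(a) = 0` automatically),
`F_{t+1} = deletePthPowers q (chartTransform q a (σ_{c,a,b c} (σ_{c',a,b c'} F_t)))`.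
[CJS2020 §12 «prepared coordinates» + Hauser2010 §F cleaning, for the walk; new] -/
theorem st_succ_F_two_shears (hs : IsRoot q s₀) (W : ForcedWalk q s₀) (t : ℕ) {a c c' : Fin 3} (hca : c ≠ a)
    (hc'a : c' ≠ a) (hcc' : c ≠ c') (hj : W.j t = a) :
    (W.st (t + 1)).F =
      deletePthPowers q (chartTransform q a (shear c a (W.b t c) (shear c' a (W.b t c') (W.st t).F))) := by
  classical
  obtain ⟨o, ho, hqo⟩ := walk_nat hs W t
  have hord : ((q : ℕ) : ℕ∞) ≤ ordZero (W.st t).F := by rw [ho]; exact_mod_cast hqo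
  have hordS : ((q : ℕ) : ℕ∞) ≤ ordZero (shear c a (W.b t c) (shear c' a (W.b t c') (W.st t).F)) :=
    le_ordZero_shear c a _ (le_ordZero_shear c' a _ hord)
  have hba : W.b t a = 0 := by rw [← hj]; exact W.onExc t
  have hbt : W.b t = Pi.single c (W.b t c) + Pi.single c' (W.b t c') := by
    funext w
    rw [Pi.add_apply]
    rcases fin3_eq_or a c c' w hca.symm hc'a.symm hcc' with rfl | rfl | rfl
    · rw [hba, Pi.single_eq_of_ne hca.symm, Pi.single_eq_of_ne hc'a.symm, add_zero]
    · rw [Pi.single_eq_same, Pi.single_eq_of_ne hcc', add_zero]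
    · rw [Pi.single_eq_of_ne (Ne.symm hcc'), Pi.single_eq_same, zero_add]
  have hstep : (W.st (t + 1)).F =
      deletePthPowers q (PointBlowup.translate (W.b t) (chartTransform q (W.j t) (W.st t).F)) := by
    rw [W.st_succ]; rfl
  have h1 : X a ^ q * PointBlowup.translate (W.b t) (chartTransform q a (W.st t).F) =
      X a ^ q * chartTransform q a (shear c a (W.b t c) (shear c' a (W.b t c') (W.st t).F)) := by
    have h2 : chartMap a (W.st t).F = X a ^ q * chartTransform q a (W.st t).F :=
      (X_pow_mul_chartTransform a hord).symm
    have h3 : chartMap a (shear c a (W.b t c) (shear c' a (W.b t c') (W.st t).F)) =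
        X a ^ q * chartTransform q a (shear c a (W.b t c) (shear c' a (W.b t c') (W.st t).F)) :=
      (X_pow_mul_chartTransform a hordS).symm
    rw [← h3, ← translate_single_chartMap hca, ← translate_single_chartMap hc'a, LossExitCone.translate_translate,
      ← hbt, h2]
    unfold PointBlowup.translate
    rw [map_mul, map_pow, aeval_X, hba, C_0, add_zero]
  have hX : (X a ^ q : MvPolynomial (Fin 3) K) ≠ 0 := pow_ne_zero _ (X_ne_zero a)
  rw [hstep, hj, mul_left_cancel₀ hX h1]

/-- Degrees `≥ q` pass through the two shears. [folklore] -/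
theorem le_degree_of_mem_support_two_shears (hs : IsRoot q s₀) (W : ForcedWalk q s₀) (t : ℕ) (a c c' : Fin 3) (g g' : K)
    {E : Fin 3 →₀ ℕ} (hE : E ∈ (shear c a g (shear c' a g' (W.st t).F)).support) : q ≤ E.degree := by
  classical
  obtain ⟨D, hD, hdeg⟩ := exists_degree_eq_of_mem_support_shear c a _ _ hE
  obtain ⟨D', hD', hdeg'⟩ := exists_degree_eq_of_mem_support_shear c' a _ _ hD
  rw [hdeg, hdeg']; exact le_degree_of_mem_support hs W t hD'

/-- **SUPPORT AT A DOUBLY TRANSLATED MOVE (PROVED):** the chart image of the cleaned support of the twice-sheared equation. [new] -/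
theorem support_succ_two_shears (hs : IsRoot q s₀) (W : ForcedWalk q s₀) (t : ℕ) {a c c' : Fin 3} (hca : c ≠ a)
    (hc'a : c' ≠ a) (hcc' : c ≠ c') (hj : W.j t = a) :
    (W.st (t + 1)).F.support =
      ((shear c a (W.b t c) (shear c' a (W.b t c') (W.st t).F)).support.filter
        fun E => ¬ IsPthPowerExponent q E).image (chartExponent q a) := by
  have hH : ∀ E ∈ (shear c a (W.b t c) (shear c' a (W.b t c') (W.st t).F)).support, q ≤ E.degree :=
    fun E hE => le_degree_of_mem_support_two_shears hs W t a c c' _ _ hE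
  rw [st_succ_F_two_shears hs W t hca hc'a hcc' hj]
  exact support_deletePthPowers_chartTransform a _ hH

/-- **COEFFICIENT TRANSPORT AT A DOUBLY TRANSLATED MOVE (PROVED):** for every exponent `E` of degree `≥ q` that is not a
`q`-th power, `coeff (chartExponent q a E) F_{t+1} = coeff E (σσF_t)` (whether or not `E` is in the support). [new] -/
theorem coeff_succ_two_shears (hs : IsRoot q s₀) (W : ForcedWalk q s₀) (t : ℕ) {a c c' : Fin 3} (hca : c ≠ a)
    (hc'a : c' ≠ a) (hcc' : c ≠ c') (hj : W.j t = a) {E : Fin 3 →₀ ℕ} (hqE : q ≤ E.degree)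
    (hPE : ¬ IsPthPowerExponent q E) :
    coeff (chartExponent q a E) (W.st (t + 1)).F = coeff E (shear c a (W.b t c) (shear c' a (W.b t c') (W.st t).F)) := by
  classical
  have hH : ∀ E ∈ (shear c a (W.b t c) (shear c' a (W.b t c') (W.st t).F)).support, q ≤ E.degree :=
    fun E hE => le_degree_of_mem_support_two_shears hs W t a c c' _ _ hE
  by_cases hE : E ∈ (shear c a (W.b t c) (shear c' a (W.b t c') (W.st t).F)).support
  · have hP : ¬ IsPthPowerExponent q (chartExponent q a E) := fun hP =>
      hPE (isPthPowerExponent_of_chartExponent hqE hP)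
    rw [st_succ_F_two_shears hs W t hca hc'a hcc' hj, coeff_deletePthPowers, if_neg hP,
      coeff_chartTransform_chartExponent _ hH hE]
  · rw [notMem_support_iff.mp hE]
    by_contra hne
    have hmem : chartExponent q a E ∈ (W.st (t + 1)).F.support := mem_support_iff.mpr hne
    rw [support_succ_two_shears hs W t hca hc'a hcc' hj, Finset.mem_image] at hmem
    obtain ⟨E', hE', hEE'⟩ := hmem
    have hE'supp := (Finset.mem_filter.mp hE').1
    have : E' = E := chartExponent_injective_of_le (hH E' hE'supp) hqE hEE'
    rw [this] at hE'supp
    exact hE hE'supp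

/-! ## §2 A shear acts degree by degree -/

omit [DecidableEq K] in
/-- If `G` has no monomial of degree `n`, neither has `σ G`. [folklore] -/
theorem coeff_shear_eq_zero_of_degree (c a : Fin 3) (g : K) (G : MvPolynomial (Fin 3) K) {n : ℕ}
    (h : ∀ D ∈ G.support, D.degree ≠ n) {E : Fin 3 →₀ ℕ} (hE : E.degree = n) : coeff E (shear c a g G) = 0 := by
  classical
  have hsum : shear c a g G = ∑ D ∈ G.support, shear c a g (monomial D (coeff D G)) := by
    conv_lhs => rw [G.as_sum]
    rw [map_sum]
  rw [hsum, coeff_sum]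
  refine Finset.sum_eq_zero fun D hD => ?_
  exact (isHomogeneous_shear_monomial c a g D (coeff D G)).coeff_eq_zero fun heq => h D hD (heq.symm.trans hE)

omit [DecidableEq K] in
/-- **HOMOGENEITY OF THE SHEAR (PROVED):** the degree-`n` coefficients of `σ G` depend only on the degree-`n` coefficients of `G`.
[folklore] -/
theorem coeff_shear_congr_degree (c a : Fin 3) (g : K) {G₁ G₂ : MvPolynomial (Fin 3) K} {n : ℕ}
    (h : ∀ D : Fin 3 →₀ ℕ, D.degree = n → coeff D G₁ = coeff D G₂) {E : Fin 3 →₀ ℕ} (hE : E.degree = n) :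
    coeff E (shear c a g G₁) = coeff E (shear c a g G₂) := by
  classical
  rw [← sub_eq_zero, ← coeff_sub, ← map_sub]
  refine coeff_shear_eq_zero_of_degree c a g (G₁ - G₂) (fun D hD hdeg => ?_) hE
  rw [mem_support_iff, coeff_sub, h D hdeg, sub_self] at hD
  exact hD rfl

/-! ## §3 The pencil at a loss in the chart of the loss wall: the prepared equation's degree-`o` part -/

section Pencil

variable {i j l : Fin 3}

omit [DecidableEq K] in
/-- **THE FREE SHEAR KILLS THE PENCIL (PROVED):** if the degree-`o` part of `F` is `φ₀·u^r·(u_l − λ u_j)^s` (`r l = 0`,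
`deg r + s = o`), then the degree-`o` part of `σ_{l,j,λ} F` is the single monomial `φ₀·u^{r + s e_l}`. [CJS2020 §12 prepared
coordinates («re-choose u₂ so that the initial form is a monomial times a power»); for the walk: new] -/
theorem coeff_shear_free_of_degree_eq (hij : i ≠ j) (hil : i ≠ l) (hjl : j ≠ l) {s o : ℕ} {r : Fin 3 →₀ ℕ} (hrl : r l = 0)
    (hro : r.degree + s = o) (φ₀ lam : K) {F : MvPolynomial (Fin 3) K} (hwall : ∀ D ∈ F.support, r ≤ D)
    (hpen : ∀ E : Fin 3 →₀ ℕ, E.degree = s → coeff (r + E) F = φ₀ * coeff E ((X l - C lam * X j) ^ s))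
    {D : Fin 3 →₀ ℕ} (hD : D.degree = o) :
    coeff D (shear l j lam F) = coeff D (monomial (r + Finsupp.single l s) φ₀) := by
  classical
  -- the degree-`o` part of `F` is that of `P := u^r · φ₀ (u_l − λ u_j)^s`
  set P : MvPolynomial (Fin 3) K := monomial r φ₀ * (X l - C lam * X j) ^ s with hP
  have hFP : ∀ D : Fin 3 →₀ ℕ, D.degree = o → coeff D F = coeff D P := by
    intro D hD
    rw [hP, coeff_monomial_mul']
    by_cases hrD : r ≤ D
    · rw [if_pos hrD]
      have hE : (D - r).degree = s := by
        have h1 : r + (D - r) = D := add_tsub_cancel_of_le hrD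
        have h2 := congrArg Finsupp.degree h1
        rw [map_add, hD] at h2
        omega
      rw [← hpen (D - r) hE, add_tsub_cancel_of_le hrD]
    · rw [if_neg hrD]
      by_contra hne
      exact hrD (hwall D (mem_support_iff.mpr hne))
  rw [coeff_shear_congr_degree l j lam hFP hD]
  -- `σ_{l,j,λ} P = φ₀ u^r u_l^s`
  have hσP : shear l j lam P = monomial (r + Finsupp.single l s) φ₀ := by
    have h1 : shear l j lam (monomial r φ₀) = monomial r φ₀ := by
      rw [shear_monomial hij.symm hjl hil lam r φ₀, hrl, zero_add, Finset.sum_range_one, shearExp_zero hij.symm hjl hil,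
        pow_zero, mul_one, Nat.choose_zero_right, Nat.cast_one, mul_one]
    have h2 : shear l j lam (X l - C lam * X j) = X l := by
      rw [map_sub, map_mul, shear_X, shear_X, if_pos rfl, if_neg hjl, algHom_C, algebraMap_eq]; ring
    rw [hP, map_mul, map_pow, h1, h2, X_pow_eq_monomial, monomial_mul, mul_one]
  rw [hσP]

omit [DecidableEq K] in
/-- **DEGREE-`o` MONOMIALS OF THE PREPARED EQUATION LIE ON THE CEILING (PROVED):** under the hypotheses of
`coeff_shear_free_of_degree_eq`, every degree-`o` monomial of `σ_{i,j,φ} σ_{l,j,λ} F` has `l`-exponent `s`. [new] -/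
theorem thd_eq_of_mem_support_two_shears (hij : i ≠ j) (hil : i ≠ l) (hjl : j ≠ l) {s o : ℕ} {r : Fin 3 →₀ ℕ} (hrl : r l = 0)
    (hro : r.degree + s = o) (φ₀ lam φ : K) {F : MvPolynomial (Fin 3) K} (hwall : ∀ D ∈ F.support, r ≤ D)
    (hpen : ∀ E : Fin 3 →₀ ℕ, E.degree = s → coeff (r + E) F = φ₀ * coeff E ((X l - C lam * X j) ^ s))
    {E : Fin 3 →₀ ℕ} (hE : E ∈ (shear i j φ (shear l j lam F)).support) (hdeg : E.degree = o) : E l = s := by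
  classical
  obtain ⟨D, hD, n, hn, hDE⟩ := exists_shearExp_eq_of_mem_support_shear hjl hij.symm hil.symm φ _ hE
  have hDl : D l = E l := by rw [← hDE, shearExp_apply_snd hjl hil.symm]
  have hDdeg : D.degree = o := by rw [← hdeg, ← hDE, degree_shearExp hjl hij.symm hil.symm D hn]
  have hcoef := mem_support_iff.mp hD
  rw [coeff_shear_free_of_degree_eq hij hil hjl hrl hro φ₀ lam hwall hpen hDdeg, coeff_monomial] at hcoef
  by_cases h : r + Finsupp.single l s = D
  · rw [← hDl, ← h, Finsupp.add_apply, hrl, Finsupp.single_eq_same, zero_add]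
  · exact absurd (if_neg h) hcoef

omit [DecidableEq K] in
/-- **THE APEX OF THE PREPARED EQUATION (PROVED):** under the same hypotheses the coefficient of `u_j^{r i + r j} u_l^s` in
`σ_{i,j,φ} σ_{l,j,λ} F` is `φ₀ φ^{r i}` (the run wall `u_i^{r i}` fully converted into `u_j`). [new] -/
theorem coeff_two_shears_apex (hij : i ≠ j) (hil : i ≠ l) (hjl : j ≠ l) {s o : ℕ} {r : Fin 3 →₀ ℕ} (hrl : r l = 0)
    (hro : r.degree + s = o) (φ₀ lam φ : K) {F : MvPolynomial (Fin 3) K} (hwall : ∀ D ∈ F.support, r ≤ D)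
    (hpen : ∀ E : Fin 3 →₀ ℕ, E.degree = s → coeff (r + E) F = φ₀ * coeff E ((X l - C lam * X j) ^ s)) :
    coeff (Finsupp.single j (r i + r j) + Finsupp.single l s) (shear i j φ (shear l j lam F)) = φ₀ * φ ^ (r i) := by
  classical
  set D₀ : Fin 3 →₀ ℕ := r + Finsupp.single l s with hD₀
  have hD₀i : D₀ i = r i := by
    rw [hD₀, Finsupp.add_apply, Finsupp.single_apply, if_neg (Ne.symm hil), add_zero]
  have hD₀j : D₀ j = r j := by
    rw [hD₀, Finsupp.add_apply, Finsupp.single_apply, if_neg (Ne.symm hjl), add_zero]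
  have hD₀l : D₀ l = s := by
    rw [hD₀, Finsupp.add_apply, hrl, Finsupp.single_eq_same, zero_add]
  have hdeg₀ : D₀.degree = o := by rw [hD₀, map_add, Finsupp.degree_single]; exact hro
  have hEdeg : (Finsupp.single j (r i + r j) + Finsupp.single l s : Fin 3 →₀ ℕ).degree = o := by
    rw [map_add, Finsupp.degree_single, Finsupp.degree_single, ← hro, degree_fin3 hij hil hjl r, hrl, add_zero]
  -- the degree-`o` coefficients of `σ_{l,j,λ} F` are those of the monomial `φ₀ u^{D₀}`
  have hcongr : ∀ D : Fin 3 →₀ ℕ, D.degree = o →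
      coeff D (shear l j lam F) = coeff D (monomial D₀ φ₀) := fun D hD =>
    coeff_shear_free_of_degree_eq hij hil hjl hrl hro φ₀ lam hwall hpen hD
  rw [coeff_shear_congr_degree i j φ hcongr hEdeg, shear_monomial hjl hij.symm hil.symm φ D₀ φ₀, coeff_sum,
    Finset.sum_eq_single (r i)]
  · rw [coeff_monomial, if_pos, hD₀i, Nat.choose_self, Nat.cast_one, mul_one]
    ext w
    rcases fin3_eq_or i j l w hij hil hjl with rfl | rfl | rfl
    · rw [shearExp_apply_thd hij.symm hil.symm, hD₀i, Nat.sub_self]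
      simp [hij.symm, Ne.symm hil]
    · rw [shearExp_apply_fst hjl hij.symm, hD₀j]
      simp [Ne.symm hjl]; ring
    · rw [shearExp_apply_snd hjl hil.symm, hD₀l]
      simp [hjl]
  · intro n hn hne
    rw [coeff_monomial, if_neg]
    intro h
    have := congrArg (fun E => E j) h
    simp only [shearExp_apply_fst hjl hij.symm, hD₀j, Finsupp.add_apply, Finsupp.single_eq_same, Finsupp.single_apply,
      if_neg (Ne.symm hjl), add_zero] at this
    omega
  · intro h
    exact absurd (Finset.mem_range.mpr (by rw [hD₀i]; omega)) h

end Pencil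

end Summit.ResolutionOfSingularities.ResolutionOfSingularities.Theorems.LossPolygon
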